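import Summits.Ventures.CertifiedQuantumChemistry.Rows.HubbardRingTVParticleHole
import HarnessLib

/-!
# Ventures/CertifiedQuantumChemistry — Rows/HubbardRingTVVacuumSector.lean: the two TRIVIAL sectors —
# the vacuum `(0, 0)` (feasible set = `{(0, 0)}`, `OPT_DQG = E₀ = E_core`) and, by the particle–hole map,
# the completely filled ring `(L, L)` (`OPT_DQG = E₀ = L·U`)

HONEST FRAMING (verbatim): certified bounds for a stated model Hamiltonian in a stated basis; not a
claim about the real molecule beyond that model.

Seat rdm-B, ROWS courtesy file (theorems only; no `def`, no notation, no instance; zero compute). The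
cell's certified quantity `Model.energy F a b` and its relaxation `Model.pqgSectorEnergy F a b` live on
the range `a, b ≤ k`; the two ENDPOINTS of that range are elementary and are typed here once, for
every model (the vacuum) and for the TV-H ring (vacuum and, through `Rows/HubbardRingTVParticleHole.lean`,
the completely filled band):

* §1 (abstract `Λ`, every DQG-feasible pair at `N = 0`) `VacuumSector.one_eq_zero`, `two_eq_zero`
  (`Tr γ = 0`, `γ ⪰ 0` ⇒ `γ = 0`; the contraction row `Σ_j Γ_{(i,j),(k,j)} = (N−1)γ_{ik} = 0` and `Γ ⪰ 0`
  ⇒ `Γ = 0` — PSD matrices with zero diagonal vanish), `rdmEnergy_zero`, **`pqgSectorEnergy_zero_zero`**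
  (`E_PQG(0, 0) = Re h_nuc`), **`sectorGroundEnergy_zero_zero`** (`E₀(Ĥ; 0, 0) = Re h_nuc` for Hermitian
  data: any unit vector of the vacuum sector has energy `h_nuc`, its RDM pair being feasible at `N = 0`);
  `Model.energy_zero_zero` / `Model.pqgSectorEnergy_zero_zero` (`= F.ecore` for every symmetric
  resp. every model `F`).
* §2 THE RING: `hubbardRingTV_energy_vacuum` / `hubbardRingTV_pqgSectorEnergy_vacuum` (`= 0`),
  **`hubbardRingTV_energy_full`** / **`hubbardRingTV_pqgSectorEnergy_full`** (`E₀(L; t, U; L, L) =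
  OPT_DQG(L; t, U; L, L) = L·U`, every `t, U`, via the particle–hole identity at `(a, b) = (0, 0)`),
  `hubbardRingTV_gap_vacuum`, `hubbardRingTV_gap_full` (both relaxation gaps vanish at the two ends of
  the filling range, every `t`, `U`).

READING: elementary endpoint facts about the cell's own objects; no certificate, row, claim node or
value of record depends on them. All PROVED (0 sorry, standard axioms); no definitions, no named facts.
References (docstring-only): D. A. Mazziotti, Adv. Chem. Phys. 134 (2007) ch. 3 §II.B eqs. (16)–(17)
(trace and contraction rows); R. A. Horn, C. R. Johnson, *Matrix Analysis* (2013) §7.1 (a PSD matrix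
with a zero diagonal entry has a zero row). Tree (REUSED): `IsDQGFeasible.one_posSemidef`,
`Literature.LinearAlgebra.Matrix.norm_apply_le_of_posSemidef`, `le_pqgSectorEnergy_iff`,
`pqgSectorEnergy_le_rdmEnergy`, `pqgSectorEnergy_le_sectorGroundEnergy`, `exists_unit_isInSector`,
`sectorGroundEnergy_le_re_rayleigh_of_unit`, `rdmEnergy_rdm`, `IsDQGFeasibleSector.of_state`,
`hubbardRingTV_energy_particleHole`, `hubbardRingTV_pqgSectorEnergy_particleHole` (gen 38).
-/

noncomputable section

namespace Summit.Ventures.CertifiedQuantumChemistry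

open Matrix Finset
open Literature.MathematicalPhysics.QuantumLattice Literature.MathematicalPhysics.QuantumChemistry
open Summit.Ventures.CertifiedQuantumChemistry.Hamiltonians
open scoped ComplexOrder

/-! ## §1 The vacuum sector of any model -/

namespace VacuumSector

section Abstract

variable {Λ : Type*} [LinearOrder Λ] [Fintype Λ]
variable {γ : Matrix (Orb Λ) (Orb Λ) ℂ} {Γ : Matrix (Orb Λ × Orb Λ) (Orb Λ × Orb Λ) ℂ}

/-- A PSD complex matrix whose diagonal vanishes is zero (`‖M_xy‖ ≤ (M_xx + M_yy)/2`). [folklore] -/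
theorem eq_zero_of_posSemidef_of_diag_eq_zero {n : Type*} [Fintype n] [DecidableEq n] {M : Matrix n n ℂ}
    (hM : M.PosSemidef) (hd : ∀ x, M x x = 0) : M = 0 := by
  ext x y
  have h := Literature.LinearAlgebra.Matrix.norm_apply_le_of_posSemidef hM x y
  rw [hd x, hd y] at h
  simpa using h

/-- **At `N = 0` every DQG-feasible one-matrix vanishes** (`Tr γ = 0`, `γ ⪰ 0`). [folklore] -/
theorem one_eq_zero (hf : IsDQGFeasible 0 γ Γ) : γ = 0 := by
  classical
  have hdiag : ∀ x : Orb Λ, γ x x = 0 := by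
    have hsum : ∑ x : Orb Λ, γ x x = 0 := by rw [hf.trace_one, Nat.cast_zero]
    have hnn : ∀ x ∈ (Finset.univ : Finset (Orb Λ)), 0 ≤ γ x x := fun x _ =>
      hf.one_posSemidef.diag_nonneg (i := x)
    exact fun x => (Finset.sum_eq_zero_iff_of_nonneg hnn).1 hsum x (Finset.mem_univ x)
  exact eq_zero_of_posSemidef_of_diag_eq_zero hf.one_posSemidef hdiag

/-- **At `N = 0` every DQG-feasible two-matrix vanishes** (the contraction row gives
`Σ_j Γ_{(i,j),(i,j)} = (0 − 1)·γ_{ii} = 0`, `Γ ⪰ 0`). [folklore] -/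
theorem two_eq_zero (hf : IsDQGFeasible 0 γ Γ) : Γ = 0 := by
  classical
  have hγ := one_eq_zero hf
  have hdiag : ∀ P : Orb Λ × Orb Λ, Γ P P = 0 := by
    rintro ⟨i, j⟩
    have hrow : ∑ j' : Orb Λ, Γ (i, j') (i, j') = 0 := by
      rw [hf.contract i i, hγ]
      simp
    have hnn : ∀ j' ∈ (Finset.univ : Finset (Orb Λ)), 0 ≤ Γ (i, j') (i, j') := fun j' _ =>
      hf.d_psd.diag_nonneg (i := (i, j'))
    exact (Finset.sum_eq_zero_iff_of_nonneg hnn).1 hrow j (Finset.mem_univ j)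
  exact eq_zero_of_posSemidef_of_diag_eq_zero hf.d_psd hdiag

omit [LinearOrder Λ] in
/-- The functional at the zero pair is the constant. [folklore] -/
theorem rdmEnergy_zero (h : Λ → Λ → ℂ) (g : Λ → Λ → Λ → Λ → ℂ) (hnuc : ℂ) :
    rdmEnergy h g hnuc 0 0 = hnuc := by
  simp [rdmEnergy]

/-- On every `(0, 0)`-sector-feasible pair the functional equals `h_nuc`. [folklore] -/
theorem rdmEnergy_of_sector_zero (h : Λ → Λ → ℂ) (g : Λ → Λ → Λ → Λ → ℂ) (hnuc : ℂ)
    (hf : IsDQGFeasibleSector 0 0 γ Γ) : rdmEnergy h g hnuc γ Γ = hnuc := by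
  rw [one_eq_zero hf.dqg, two_eq_zero hf.dqg, rdmEnergy_zero]

/-- **`E_PQG(0, 0) = Re h_nuc`**: the vacuum sector's DQG value is the constant. [folklore] -/
theorem pqgSectorEnergy_zero_zero (h : Λ → Λ → ℂ) (g : Λ → Λ → Λ → Λ → ℂ) (hnuc : ℂ) :
    pqgSectorEnergy h g hnuc 0 0 = hnuc.re := by
  refine le_antisymm ?_ ((le_pqgSectorEnergy_iff h g hnuc (Nat.zero_le _) (Nat.zero_le _)).2
    fun γ Γ hf => (congrArg Complex.re (rdmEnergy_of_sector_zero h g hnuc hf)).ge)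
  obtain ⟨E, γ, Γ, hf, rfl⟩ := pqgSectorEnergySet_nonempty h g hnuc (a := 0) (b := 0) (Nat.zero_le _)
    (Nat.zero_le _)
  calc pqgSectorEnergy h g hnuc 0 0 ≤ (rdmEnergy h g hnuc γ Γ).re := pqgSectorEnergy_le_rdmEnergy h g hnuc hf
    _ = hnuc.re := by rw [rdmEnergy_of_sector_zero h g hnuc hf]

/-- **`E₀(Ĥ; 0, 0) = Re h_nuc`** for Hermitian data: the vacuum sector's energy is the constant (any
unit vector of the sector has RDM pair `(0, 0)`, hence energy `h_nuc`; below, `E₀ ≥ E_PQG = Re h_nuc`).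
[folklore] -/
theorem sectorGroundEnergy_zero_zero {h : Λ → Λ → ℂ} {g : Λ → Λ → Λ → Λ → ℂ} {hnuc : ℂ}
    (hH : (molecularHamiltonian h g hnuc).IsHermitian) :
    sectorGroundEnergy (molecularHamiltonian h g hnuc) 0 0 = hnuc.re := by
  refine le_antisymm ?_ ?_
  · obtain ⟨ψ, hψ, hψ1⟩ := exists_unit_isInSector (Λ := Λ) (a := 0) (b := 0) (Nat.zero_le _) (Nat.zero_le _)
    have h1 := sectorGroundEnergy_le_re_rayleigh_of_unit hH hψ hψ1
    rwa [← rdmEnergy_rdm h g hnuc hψ1,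
      rdmEnergy_of_sector_zero h g hnuc (IsDQGFeasibleSector.of_state hψ hψ1)] at h1
  · rw [← pqgSectorEnergy_zero_zero h g hnuc]
    exact pqgSectorEnergy_le_sectorGroundEnergy hH (Nat.zero_le _) (Nat.zero_le _)

end Abstract

end VacuumSector

/-- **THE VACUUM SECTOR OF A MODEL**: `Model.pqgSectorEnergy F 0 0 = F.ecore` for every model `F`. -/
theorem Model.pqgSectorEnergy_zero_zero {k : ℕ} (F : Model k) : F.pqgSectorEnergy 0 0 = (F.ecore : ℝ) := by
  unfold Model.pqgSectorEnergy
  rw [VacuumSector.pqgSectorEnergy_zero_zero, Complex.ratCast_re]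

/-- **THE VACUUM SECTOR OF A SYMMETRIC MODEL**: `Model.energy F 0 0 = F.ecore`. -/
theorem Model.energy_zero_zero {k : ℕ} {F : Model k} (hF : F.IsSymmetric) : F.energy 0 0 = (F.ecore : ℝ) := by
  unfold Model.energy Model.hamiltonian
  rw [VacuumSector.sectorGroundEnergy_zero_zero (Model.hamiltonian_isHermitian hF), Complex.ratCast_re]

/-! ## §2 The ring: the vacuum and the completely filled band -/

section Ring

variable (L : ℕ) (t U : ℚ)

/-- `E₀(hubbardRingTV L t U; 0, 0) = 0` (the vacuum; `E_core = 0`). [folklore] -/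
theorem hubbardRingTV_energy_vacuum : Model.energy (hubbardRingTV L t U) 0 0 = 0 := by
  rw [Model.energy_zero_zero (hubbardRingTV_isSymmetric L t U)]
  simp [hubbardRingTV]

/-- `OPT_DQG(hubbardRingTV L t U; 0, 0) = 0`. [folklore] -/
theorem hubbardRingTV_pqgSectorEnergy_vacuum : Model.pqgSectorEnergy (hubbardRingTV L t U) 0 0 = 0 := by
  rw [Model.pqgSectorEnergy_zero_zero]
  simp [hubbardRingTV]

/-- **THE COMPLETELY FILLED RING**: `E₀(hubbardRingTV L t U; L, L) = L·U` for every `t, U` (the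
particle–hole image of the vacuum of `hubbardRingTV L (−t) U`: every orbital doubly occupied, the
hopping blocked, `U` per site). [folklore] -/
theorem hubbardRingTV_energy_full : Model.energy (hubbardRingTV L t U) L L = (L : ℝ) * U := by
  have h := hubbardRingTV_energy_particleHole (L := L) (-t) U (Nat.zero_le L) (Nat.zero_le L)
  rw [neg_neg, Nat.sub_zero, hubbardRingTV_energy_vacuum] at h
  rw [h]
  push_cast
  ring

/-- **`OPT_DQG(hubbardRingTV L t U; L, L) = L·U`** likewise — the relaxation is exact on the full band.
[folklore] -/
theorem hubbardRingTV_pqgSectorEnergy_full : Model.pqgSectorEnergy (hubbardRingTV L t U) L L = (L : ℝ) * U := by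
  have h := hubbardRingTV_pqgSectorEnergy_particleHole (L := L) (-t) U (Nat.zero_le L) (Nat.zero_le L)
  rw [neg_neg, Nat.sub_zero, hubbardRingTV_pqgSectorEnergy_vacuum] at h
  rw [h]
  push_cast
  ring

/-- The certified gap vanishes in the vacuum sector. [folklore] -/
theorem hubbardRingTV_gap_vacuum :
    Model.energy (hubbardRingTV L t U) 0 0 - Model.pqgSectorEnergy (hubbardRingTV L t U) 0 0 = 0 := by
  rw [hubbardRingTV_energy_vacuum, hubbardRingTV_pqgSectorEnergy_vacuum, sub_zero]

/-- The certified gap vanishes on the completely filled ring. [folklore] -/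
theorem hubbardRingTV_gap_full :
    Model.energy (hubbardRingTV L t U) L L - Model.pqgSectorEnergy (hubbardRingTV L t U) L L = 0 := by
  rw [hubbardRingTV_energy_full, hubbardRingTV_pqgSectorEnergy_full, sub_self]

end Ring

end Summit.Ventures.CertifiedQuantumChemistry

end
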